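import Literature.AnabelianGeometry.AbsoluteAnabelian.GaloisTheatersNonVacuity
import HarnessLib

/-!
# [pGC] Thm A / 16.5 conclusion `RelativeAnabelianDatum.RelHomGC` — CLOSED INSTANCE FORM at the one-object
# datum over the point (FACT-LIST row F-1792)

S. Mochizuki, *The local pro-p anabelian geometry of curves*, Invent. Math. **138** (1999)
[cite: MochizukiLocAn1999], Theorem A p. 3 (profinite form Thm 16.5 p. 86): "the natural map
`Hom^{dom}_K(X_K, Y_K) → Hom^{open}_{Γ_K}(Π_{X_K}, Π_{Y_K})` … is bijective".  The tree types the CONCLUSION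
as the predicate `RelativeAnabelianDatum.RelHomGC D` on an interface datum `D : RelativeAnabelianDatum G`
(`RelativeGrothendieckConjecture.lean`, abc-iut-L4-t13).  PROOF-ONLY companion (theorems only; no `def`).

Bookkeeping context (abc-iut cell, block F, row INST59C of the LF kernel census): the universal closure of
F-1792 is REFUTED in tree (`RelativeAnabelianDatum.not_forall_relHomGC`: the junk datum with `Hom = ∅`
over the point) and the row is model-witnessed only inside `∃`-statements (`RelativeAnabelianDatum.exists_point`,
`exists_point_functoriality`).  This file states the model witness with conclusion head LITERALLY the
FACT-LIST declaration, at the datum written out as a term (the same literal the tree's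
`AugmentedProfiniteGrp.outerHom_point_eq` is stated over):

* `RelativeAnabelianDatum.relHomGC_pointDatum G` — the ONE-OBJECT DATUM OVER THE POINT (`Π_X := G ↠ G`
  the identity, `Hom = {id}` declared an isomorphism and a hyperbolic curve, `Σ := Set.univ`, `f ↦ [id]`)
  satisfies `RelHomGC`: outer homomorphisms over the point form a singleton (`outerHom_point_eq`) and the
  class of the identity is open; so "the natural map" is a bijection `{id} → {[id]}`;
* `RelativeAnabelianDatum.relIsomGC_pointDatum G` — the same datum satisfies the isomorphism version
  `RelIsomGC` (conclusion of [Tpcs] Thm 4.12), for consumers that bind both.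

HONEST LABEL: DEGENERATE (`Δ = 1`; no hyperbolic curve has trivial geometric fundamental group) — a
joint-satisfiability statement about OUR typed interface, exactly the instance the closure refuter's
`Hom = ∅` junk spares; nothing of [pGC] is asserted or denied; the intended datum (étale `π₁` of smooth
varieties over a sub-`p`-adic field) is not constructible in the tree and Thm A stays a NAMED FACT there.
Instantiated ≠ endorsed; typed ≠ proved; nothing here bears on [IUTchIII] Cor. 3.12.
-/

universe u

namespace Literature.AnabelianGeometry.AbsoluteAnabelian

namespace RelativeAnabelianDatum

variable (G : ProfiniteGrp.{u})

/-- **F-1792, CLOSED INSTANCE FORM**: the one-object datum over the point `Π = G ↠ G` (`Hom = {id}`,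
`Σ = Set.univ`, `f ↦ [id]`) has the relative hom-version 'GC' property `RelHomGC` — tautologically:
every outer homomorphism over the point is `[id]` (`AugmentedProfiniteGrp.outerHom_point_eq`), and `[id]`
is open.  DEGENERATE model witness (`Δ = 1`). [cite: MochizukiLocAn1999, Thm A p.3] -/
theorem relHomGC_pointDatum :
    Literature.AnabelianGeometry.AbsoluteAnabelian.RelativeAnabelianDatum.RelHomGC
      ({ Obj := PUnit.{u + 1}
         Hom := fun _ _ => PUnit.{u + 1}
         IsIso := fun _ => True
         IsHyperbolicCurve := fun _ => True
         primes := Set.univ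
         grp := fun _ =>
           { arith := G, aug := ContinuousMonoidHom.id G, aug_surjective := Function.surjective_id }
         outerHom := fun _ =>
           AugmentedProfiniteGrp.OuterHom.mk ⟨ContinuousMonoidHom.id _, fun _ => rfl⟩ } :
        RelativeAnabelianDatum G) := by
  intro X Y _
  refine ⟨fun _ _ => ?_, fun _ _ _ _ _ => Subsingleton.elim _ _, fun c _ => ⟨PUnit.unit, trivial, ?_⟩⟩
  · show (AugmentedProfiniteGrp.OuterHom.mk _).IsOpen
    rw [AugmentedProfiniteGrp.OuterHom.isOpen_mk, AugmentedProfiniteGrp.HomOver.IsOpenHom]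
    have h : Set.range
        ((⟨ContinuousMonoidHom.id _, fun _ => rfl⟩ :
          AugmentedProfiniteGrp.HomOver
            ({ arith := G, aug := ContinuousMonoidHom.id G, aug_surjective := Function.surjective_id } :
              AugmentedProfiniteGrp G)
            ({ arith := G, aug := ContinuousMonoidHom.id G, aug_surjective := Function.surjective_id } :
              AugmentedProfiniteGrp G)).toHom) = Set.univ :=
      Set.range_eq_univ.mpr Function.surjective_id
    rw [h]
    exact isOpen_univ
  · exact AugmentedProfiniteGrp.outerHom_point_eq _ _

/-- The same datum satisfies the isomorphism version `RelIsomGC` (conclusion of [Tpcs] Thm 4.12 as typed):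
over the point the only outer homomorphism `[id]` is an outer isomorphism and `Hom = Isom = {id}`.
DEGENERATE model witness. [cite: MochizukiTopics2003, Thm 4.12 p.44] -/
theorem relIsomGC_pointDatum :
    Literature.AnabelianGeometry.AbsoluteAnabelian.RelativeAnabelianDatum.RelIsomGC
      ({ Obj := PUnit.{u + 1}
         Hom := fun _ _ => PUnit.{u + 1}
         IsIso := fun _ => True
         IsHyperbolicCurve := fun _ => True
         primes := Set.univ
         grp := fun _ =>
           { arith := G, aug := ContinuousMonoidHom.id G, aug_surjective := Function.surjective_id }
         outerHom := fun _ =>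
           AugmentedProfiniteGrp.OuterHom.mk ⟨ContinuousMonoidHom.id _, fun _ => rfl⟩ } :
        RelativeAnabelianDatum G) := by
  intro X₁ X₂ _ _
  refine ⟨fun _ _ => ?_, fun _ _ _ _ _ => Subsingleton.elim _ _, fun c _ => ⟨PUnit.unit, trivial, ?_⟩⟩
  · show (AugmentedProfiniteGrp.OuterHom.mk _).IsIso
    rw [AugmentedProfiniteGrp.OuterHom.isIso_mk]
    exact Function.bijective_id
  · exact AugmentedProfiniteGrp.outerHom_point_eq _ _

end RelativeAnabelianDatum

end Literature.AnabelianGeometry.AbsoluteAnabelian
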